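import Summits.QuantumFields.YangMills.Theorems.AllWindowsColdBoxBoxHighLineSmearedFPOperatorFloor
import Summits.QuantumFields.YangMills.Theorems.AllWindowsColdBoxBoxHighLineSmearedFPOperatorPerturbation
import Summits.QuantumFields.YangMills.Theorems.AllWindowsColdBoxBoxHighLinePerturbedInverseRows
import Summits.QuantumFields.YangMills.Theorems.AllWindowsColdBoxBoxHighLineDirichletGreenHilbertSchmidt

/-!
# ℓ² ROW sums of the inverse Faddeev–Popov operator: `Σ_t ((fpOperator H V)⁻¹ p t)² ≤ C·(1 + log H)⁴` on the `r₀`-ball, `C·r₀·H² ≤ 1`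
# (the row input `hrow` of J4 `OrbitMapBulkSurj` / the self-map step of T-S5.4J; LINE-19 S5 ⟨stmt-QuantumFields-24004⟩/⟨24335⟩, LINE-20 U5 ⟨24336⟩)

Width seat `ym-line-sfw-p2-w4` (prover-ym-line-sfw-p2-w4-g27-0), J4 holder.  Assembly of four landed pieces:
* ✓`dirichletGreenRowSqSum` (LEAD g77, 4i, `…DirichletGreenHilbertSchmidt`): `Σ_t ((boxLap (2H) univ)⁻¹ s t)² ≤ C_HS (1 + log H)⁴`;
* ✓`SpectralFloor.boxLap_univ_apply_eq_dirichletMatrix` (part 3 of 4f-L²): `boxLap (2H) univ` is the Dirichlet Laplacian matrix of its point set — here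
  turned into **`dirichletMatrix_interior_submatrix_eq_boxLap`**: `(dirichletMatrix (interiorSites H)).submatrix e e = boxLap (2H) univ` for the coordinate
  bijection `e : Box 4 (2H) univ ≃ interiorSites H` (`coordsEquivInterior_bijective`; the entries of `dirichletMatrix Λ` depend only on the points,
  `dirichletMatrix_apply_eq_of_val_eq`), whence **`interiorGreen_row_sq_le`**: `Σ_y ((dirichletMatrix (interiorSites H))⁻¹ x y)² ≤ C_HS (1 + log H)⁴`;
* ✓`fpOperator_one` (w2, 4c): `F(1) = −(Δ_I ⊗ₖ pauliPerm)`, so `F(1)⁻¹ = −(Δ_I⁻¹ ⊗ₖ pauliPerm)` (`fpOperator_one_inv`) and the rows of `F(1)⁻¹` have the same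
  ℓ² sums as the rows of `Δ_I⁻¹` (**`fpOperator_one_inv_row_sq_eq`**; each row of the signed permutation carries one `±1`);
* ✓`SpectralFloor.inv_row_sq_le_four_mul` (LEAD g77, 4v) with the floor `l = (1/4)/H²` of ✓`SpectralFloor.fpOperator_one_opFloor` (4f-L² closer) and the
  perturbation bound `m = 252·r₀` of ✓`fpOperator_sub_one_opBound_of_linkDefect` (w2, 4c-E): rows of `F(V)⁻¹` are at most `4×` the rows of `F(1)⁻¹`
  as soon as `2016·r₀·H² ≤ 1`.
Result **`fpOperator_inv_row_sq_le`**, stated EXACTLY as the hypothesis `hrow` of ✓/⧗`orbitMapBulkSurj_of`: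
`∃ C_r > 0, ∀ H ≥ 1, ∀ r₀ ≥ 0, C_r·r₀·H² ≤ 1 → ∀ V (links ≤ r₀²), ∀ p, Σ_t ((fpOperator H V)⁻¹ p t)² ≤ C_r·(1 + log H)⁴` (`C_r = 4·C_HS + 2017`).

Everything proved; no definitions; standard axioms.  HONEST LABEL: an elementary glue lemma of step (1b)/(1c) of the XL stubs S5/U5 of critic-PASSed DRAFT
lines on the R2ξ″ cruxes; T-S5.4J, S5, U5 and the items ⟨24004⟩ ⟨24335⟩ ⟨24336⟩ remain OPEN; no stub is closed by name, no crux, rung or summit is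
proved; the Yang–Mills mass gap is NOT proved by this file.
-/

set_option autoImplicit false

open Matrix Finset
open scoped Kronecker
open Literature.MathematicalPhysics.QuantumFieldTheory.AxialGauge (boxEdges)
open Literature.MathematicalPhysics.QuantumLattice (LGConfig)
open Literature.Probability.LatticeModels (Site dirichletMatrix zdGraph)
open Summit.QuantumFields.YangMills.Theorems.AllWindowsColdBox.BoxKernel (Box boxLap coords coords_injective)

namespace Summit.QuantumFields.YangMills.Theorems.AllWindowsColdBoxBoxHighLine

namespace OrbitMapSurj

variable {H : ℕ}

/-! ## 1. `Box 4 (2H) univ ≃ interiorSites H` and the reindexed Dirichlet Laplacian -/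

/-- The coordinates of a point of `Box 4 (2H) univ` form an interior site. -/
theorem coords_mem_interiorSites (s : Box 4 (2 * H) Finset.univ) : coords s ∈ interiorSites H := by
  rw [interiorSites, Fintype.mem_piFinset]
  intro k
  rw [Finset.mem_Icc]
  have h0 : (s.1 k : ℕ) ≠ 0 := s.2 k (Finset.mem_univ k)
  have hM : (s.1 k : ℕ) < 2 * H := (s.1 k).isLt
  simp only [coords]
  constructor
  · exact_mod_cast Nat.one_le_iff_ne_zero.2 h0
  · have : (s.1 k : ℕ) + 1 ≤ 2 * H := hM
    have h' : ((s.1 k : ℕ) : ℤ) + 1 ≤ 2 * (H : ℤ) := by exact_mod_cast this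
    linarith

/-- The coordinate map `Box 4 (2H) univ → interiorSites H` is a bijection. -/
theorem coordsEquivInterior_bijective :
    Function.Bijective (fun s : Box 4 (2 * H) Finset.univ => (⟨coords s, coords_mem_interiorSites s⟩ : ↥(interiorSites H))) := by
  refine ⟨fun s t h => coords_injective (Subtype.ext_iff.1 h), fun x => ?_⟩
  have hx := Fintype.mem_piFinset.1 x.2
  have hk : ∀ k : Fin 4, 1 ≤ x.1 k ∧ x.1 k ≤ 2 * (H : ℤ) - 1 := fun k => Finset.mem_Icc.1 (hx k)
  refine ⟨⟨fun k => ⟨(x.1 k).toNat, by have := hk k; omega⟩, fun k _ => by have := hk k; simp; omega⟩, ?_⟩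
  apply Subtype.ext
  funext k
  have := hk k
  simp only [coords]
  omega

/-- The entries of `dirichletMatrix Λ` depend only on the underlying points. -/
theorem dirichletMatrix_apply_eq_of_val_eq {d : ℕ} (Λ Λ' : Finset (Site d)) (x y : ↥Λ) (x' y' : ↥Λ')
    (hx : (x : Site d) = x') (hy : (y : Site d) = y') : dirichletMatrix Λ x y = dirichletMatrix Λ' x' y' := by
  unfold dirichletMatrix
  have h1 : (x = y) ↔ (x' = y') := by
    rw [Subtype.ext_iff, Subtype.ext_iff, hx, hy]
  by_cases h : x = y
  · rw [if_pos h, if_pos (h1.1 h)]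
  · rw [if_neg h, if_neg (fun h' => h (h1.2 h')), hx, hy]

/-- **The interior Dirichlet Laplacian matrix, reindexed along `coords`, is `boxLap (2H) univ`.** -/
theorem dirichletMatrix_interior_submatrix_eq_boxLap :
    (dirichletMatrix (interiorSites H)).submatrix
        (Equiv.ofBijective _ (coordsEquivInterior_bijective (H := H)))
        (Equiv.ofBijective _ (coordsEquivInterior_bijective (H := H))) =
      boxLap (2 * H) Finset.univ := by
  ext s t
  rw [Matrix.submatrix_apply, SpectralFloor.boxLap_univ_apply_eq_dirichletMatrix]
  exact dirichletMatrix_apply_eq_of_val_eq _ _ _ _ _ _ rfl rfl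

/-- **ℓ² rows of the interior Dirichlet Green's function**: `Σ_y ((dirichletMatrix (interiorSites H))⁻¹ x y)² ≤ C (1 + log H)⁴` (✓4i, transported). -/
theorem interiorGreen_row_sq_le : ∃ C : ℝ, 0 ≤ C ∧ ∀ H : ℕ, 1 ≤ H → ∀ x : ↥(interiorSites H),
    ∑ y, ((dirichletMatrix (interiorSites H))⁻¹ x y) ^ 2 ≤ C * (1 + Real.log H) ^ 4 := by
  obtain ⟨C, hC, hrow⟩ := dirichletGreenRowSqSum
  refine ⟨C, hC, fun H hH x => ?_⟩
  set e := Equiv.ofBijective _ (coordsEquivInterior_bijective (H := H)) with he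
  have hinv : (boxLap (2 * H) Finset.univ)⁻¹ = ((dirichletMatrix (interiorSites H))⁻¹).submatrix e e := by
    rw [← dirichletMatrix_interior_submatrix_eq_boxLap, Matrix.inv_submatrix_equiv]
  have h := hrow H hH (e.symm x)
  rw [hinv] at h
  simp only [Matrix.submatrix_apply, Equiv.apply_symm_apply] at h
  rwa [e.sum_comp (fun y => ((dirichletMatrix (interiorSites H))⁻¹ x y) ^ 2)] at h

/-! ## 2. Rows of `F(1)⁻¹ = −(Δ_I⁻¹ ⊗ₖ pauliPerm)` -/

/-- `F(1)⁻¹ = −(Δ_I⁻¹ ⊗ₖ pauliPerm)` (`pauliPerm² = 1`). -/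
theorem fpOperator_one_inv (H : ℕ) :
    (fpOperator H 1)⁻¹ = -((dirichletMatrix (interiorSites H))⁻¹ ⊗ₖ pauliPerm) := by
  have hPP : pauliPerm * pauliPerm = 1 := by
    ext i j; fin_cases i <;> fin_cases j <;> simp [pauliPerm, Matrix.mul_apply, Fin.sum_univ_three]
  have hD : IsUnit (dirichletMatrix (interiorSites H)).det :=
    Literature.Probability.LatticeModels.isUnit_det_dirichletMatrix (by norm_num) _
  apply Matrix.inv_eq_right_inv
  rw [fpOperator_one, neg_mul_neg, ← Matrix.mul_kronecker_mul, Matrix.mul_nonsing_inv _ hD, hPP, Matrix.one_kronecker_one]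

/-- Each row of the signed permutation `pauliPerm` carries exactly one `±1`. -/
theorem pauliPerm_row_sq (b : Fin 3) : ∑ b', pauliPerm b b' ^ 2 = 1 := by
  fin_cases b <;> simp [pauliPerm, Fin.sum_univ_three]

/-- **Rows of `F(1)⁻¹` have the ℓ² sums of the rows of `Δ_I⁻¹`.** -/
theorem fpOperator_one_inv_row_sq_eq (p : ↥(interiorSites H) × Fin 3) :
    ∑ t, ((fpOperator H 1)⁻¹ p t) ^ 2 = ∑ y, ((dirichletMatrix (interiorSites H))⁻¹ p.1 y) ^ 2 := by
  rw [fpOperator_one_inv, Fintype.sum_prod_type]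
  refine Finset.sum_congr rfl fun y _ => ?_
  simp only [Matrix.neg_apply, Matrix.kroneckerMap_apply, neg_sq, mul_pow]
  rw [← Finset.mul_sum, pauliPerm_row_sq, mul_one]

/-! ## 3. Rows of `F(V)⁻¹` on the `r₀`-ball -/

/-- **ℓ² row sums of `(fpOperator H V)⁻¹`** — exactly the hypothesis `hrow` of `orbitMapBulkSurj_of`. -/
theorem fpOperator_inv_row_sq_le : ∃ C_r : ℝ, 0 < C_r ∧ ∀ H : ℕ, 1 ≤ H → ∀ r₀ : ℝ, 0 ≤ r₀ → C_r * r₀ * (H : ℝ) ^ 2 ≤ 1 →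
    ∀ V : LGConfig 4 SU2, (∀ e ∈ boxEdges 4 (2 * H + 1), linkDefect V e ≤ r₀ ^ 2) →
      ∀ p : ↥(interiorSites H) × Fin 3, ∑ t, ((fpOperator H V)⁻¹ p t) ^ 2 ≤ C_r * (1 + Real.log H) ^ 4 := by
  obtain ⟨C, hC, hrow⟩ := interiorGreen_row_sq_le
  refine ⟨4 * C + 2017, by positivity, fun H hH r₀ hr₀ hCr V hV p => ?_⟩
  have hH' : (1 : ℝ) ≤ H := by exact_mod_cast hH
  have hH2 : (1 : ℝ) ≤ (H : ℝ) ^ 2 := one_le_pow₀ hH'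
  have hlog : 0 ≤ Real.log H := Real.log_nonneg hH'
  -- the regime: `r₀ ≤ 1` and `2·(252 r₀) ≤ (1/4)/H²`
  have hr₀1 : r₀ ≤ 1 := by nlinarith [mul_nonneg (by positivity : (0 : ℝ) ≤ 4 * C + 2016) hr₀, mul_nonneg hr₀ (sub_nonneg.2 hH2)]
  have h2m : 2 * (252 * r₀) ≤ 1 / 4 / (H : ℝ) ^ 2 := by
    rw [le_div_iff₀ (by positivity)]
    nlinarith [mul_nonneg (by positivity : (0 : ℝ) ≤ 4 * C + 1) (mul_nonneg hr₀ (zero_le_one.trans hH2))]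
  have hl : 0 < 1 / 4 / (H : ℝ) ^ 2 := by positivity
  have hA : ∀ v : ↥(interiorSites H) × Fin 3 → ℝ,
      (1 / 4 / (H : ℝ) ^ 2) ^ 2 * (v ⬝ᵥ v) ≤ (fpOperator H 1 *ᵥ v) ⬝ᵥ (fpOperator H 1 *ᵥ v) := by
    intro v
    have he : (1 / 4 / (H : ℝ) ^ 2) ^ 2 = 1 / 16 / (H : ℝ) ^ 4 := by
      have : (H : ℝ) ≠ 0 := by positivity
      field_simp; ring
    rw [he]
    exact SpectralFloor.fpOperator_one_opFloor hH v
  have hE := fpOperator_sub_one_opBound_of_linkDefect V hr₀ hr₀1 hV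
  have h := SpectralFloor.inv_row_sq_le_four_mul (fpOperator H 1) (fpOperator H V - fpOperator H 1) hl (by positivity) h2m hA hE p
  rw [add_sub_cancel, fpOperator_one_inv_row_sq_eq] at h
  calc ∑ t, ((fpOperator H V)⁻¹ p t) ^ 2 ≤ 4 * ∑ y, ((dirichletMatrix (interiorSites H))⁻¹ p.1 y) ^ 2 := h
    _ ≤ 4 * (C * (1 + Real.log H) ^ 4) := mul_le_mul_of_nonneg_left (hrow H hH p.1) (by norm_num)
    _ ≤ (4 * C + 2017) * (1 + Real.log H) ^ 4 := by nlinarith [pow_nonneg (add_nonneg zero_le_one hlog) 4]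

end OrbitMapSurj

end Summit.QuantumFields.YangMills.Theorems.AllWindowsColdBoxBoxHighLine
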